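import Summits.QuantumFields.BalabanUV.Beta.SymSecondOrderTablesAn1

/-!
# `BalabanUV.Beta.SymTablesOf` — row D1 ∕ (C1), file F6b: THE GENERIC `SymTables` PACKER `tabsOf` — a table record from five tables and
# their eight letters, the multiplier tables DERIVED from the Hessian table (`M j μ w := cM j • H μ w`, the `M1Of` shape); an1's records
# `symTablesAn1` ∕ `symTablesAn1S2` are its instances by `rfl`

WHAT.  `SymmetrisedStepJets.SymTables d N` displays five tables `V H M vh₂S mixFF` and ten letters; in every record of the row the multiplier
tables are a scalar family times the constraint Hessian (`M1Of d N H cΛ j μ w = (cΛ·wM1 j) • H μ w`, `MultiplierTableSlot.M1Of_apply`), so (LM)(TM)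
follow from (LH)(TH).  §1 `tabsOf N V H cM vh₂S mixFF hV hH hB hmix hVt hHt hBt hmixt : SymTables d N` — eight letters in, ten out
(`hM` from `hH` at rate `1` by `biLoc_smul_ff`, `hMt` from `hHt`); field projections (`rfl`); `tabsOf_M_apply`.  §2 THE INSTANCES BY `rfl`:
**`symTablesAn1_eq_tabsOf`**, **`symTablesAn1S2_eq_tabsOf`** (an1's (0.4) record IS `tabsOf` at an1's tables with `cM j = cΛ·wM1 j`).
WHY (located).  SPEC S-an2-g49-1 v1.1 §1 ∕ ADDENDUM S-an2-g51-1 §5: the composite record `tabsComp m : SymTables 3 (Lc^m)` (F6) — and, under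
design (D-b), any `SymTables` packaging road BF-x may want of the composite jets — is ASSEMBLED from F3 (`compVhS`, (LV)(TV)), F6a (`compHessFF`,
(LH)(TH)), F5 (`compVh2S`, (LB)(TB)), F6c (composite mixed table, (Lmix)(Tmix)); this file is the fork-free assembler, checked against the
record of record.  [folklore] packaging BY NAME; ONE [our object — bookkeeping] def (`tabsOf`, a constructor call); nothing of Bałaban's
asserted, valued or discharged; 0 estimates; 0∕4 row-D1 binders; NOT (C1), NOT D1, NEVER «G-an2-4 closed», NOT BetaPertH, NOT continuum, NOT Clay.

HONEST DEPENDENCY (page 1, mandatory): continuum YM on T⁴ ⇐ BetaPertH ∧ nine spine estimates (0/9 proved); BetaPertH ⇐ (D1) ∧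
(D4) ∧ CAP+tail; G-an2-4 gates asym, D1 and NE2/3/4.  Row D1 ∕ (C1) OWNER an2, gen 51, 2026-08-23.  No existing file touched.
-/

noncomputable section

namespace Summit.QuantumFields.BalabanUV.Beta.SymTablesOf

open Literature.MathematicalPhysics.QuantumFieldTheory.Balaban1983to89
open Literature.MathematicalPhysics.QuantumFieldTheory.Balaban1983to89.Beta
open ExpKernelCalculus (MKer BiLoc VertexFamily shiftK)
open OneStepResolventKernel (Fib LocStencil)
open AffineAveraging (Site)
open AveragingContoursRooted (ctr)
open BalabanCompositeJets (LocStencil₂)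
open SecondOrderResponse (LocStencilFM)
open BalabanStepW2 (wM1)
open Summit.QuantumFields.BalabanUV.Beta.AxialDressingRooted (one_le_of_neZero)
open Summit.QuantumFields.BalabanUV.Beta.SpineRooted (M1Of)
open Summit.QuantumFields.BalabanUV.Beta.SymmetrisedStepJets (SymTables)
open Summit.QuantumFields.BalabanUV.Beta.SymAveragingHessianCounts (symVhSAt symHessFFAt symVhSAt_hV_ctr symHessFFAt_hH_ctr symVhSAt_hVt_ctr
  symHessFFAt_hHt_ctr biLoc_smul_ff)
open Summit.QuantumFields.BalabanUV.Beta.SymTablesAn1FirstOrder (symTablesAn1)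
open Summit.QuantumFields.BalabanUV.Beta.SymAveragingMixedJetTables (symMixFFAt)
open Summit.QuantumFields.BalabanUV.Beta.SymSecondOrderTablesAn1 (symTablesAn1S2 symVh₂SAn1 locStencil₂_symVh₂SAn1 symMixFFAt_hmix_ctr
  symVh₂SAn1_hBt symMixFFAt_hmixt)

variable {d : ℕ}

/-! ## §1 The packer -/

section Def

variable (N : ℕ)
  (V H : Fin (d + 1) → Site (d + 1) → MKer (d + 1) (Fib d)) (cM : ℕ → ℝ)
  (vh₂S mixFF : Fin (d + 1) → Site (d + 1) → Fin (d + 1) → Site (d + 1) → MKer (d + 1) (Fib d))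
  (hV : ∀ δ : ℝ, 0 ≤ δ → ∃ C : ℝ, LocStencil V C δ) (hH : ∀ δ : ℝ, 0 ≤ δ → ∃ C : ℝ, VertexFamily H N C δ)
  (hB : ∃ C δ : ℝ, 0 < δ ∧ LocStencil₂ vh₂S C δ) (hmix : ∃ C δ : ℝ, 0 < δ ∧ LocStencilFM N mixFF C δ)
  (hVt : ∀ (κ : Fin (d + 1)) (u t : Site (d + 1)), V κ (u + (N : ℤ) • t) = shiftK (-((N : ℤ) • t)) (V κ u))
  (hHt : ∀ (μ : Fin (d + 1)) (y t : Site (d + 1)), H μ (y + t) = shiftK (-((N : ℤ) • t)) (H μ y))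
  (hBt : ∀ (κ : Fin (d + 1)) (u : Site (d + 1)) (κ' : Fin (d + 1)) (u' t : Site (d + 1)),
    vh₂S κ (u + (N : ℤ) • t) κ' (u' + (N : ℤ) • t) = shiftK (-((N : ℤ) • t)) (vh₂S κ u κ' u'))
  (hmixt : ∀ (κ : Fin (d + 1)) (u : Site (d + 1)) (μ : Fin (d + 1)) (w t : Site (d + 1)),
    mixFF κ (u + (N : ℤ) • t) μ (w + t) = shiftK (-((N : ℤ) • t)) (mixFF κ u μ w))

/-- [our object — bookkeeping] **THE GENERIC TABLE RECORD**: five tables + eight letters in, a `SymTables d N` out; the multiplier tables are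
`M j μ w := cM j • H μ w` (the `M1Of` shape), their letters (LM) (at rate `1`, constant `|cM j|·C_H(1)`) and (TM) derived from `H`'s. -/
def tabsOf : SymTables d N where
  V := V
  H := H
  M := fun j μ w => cM j • H μ w
  vh₂S := vh₂S
  mixFF := mixFF
  hV := hV
  hH := hH
  hM := fun j => by
    obtain ⟨C, hC⟩ := hH 1 zero_le_one
    exact ⟨_, 1, one_pos, fun μ w => biLoc_smul_ff (hC μ w) (cM j)⟩
  hB := hB
  hmix := hmix
  hVt := hVt
  hHt := hHt
  hMt := fun j μ w t => by
    funext x z a b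
    simp only [Pi.smul_apply, smul_eq_mul, shiftK]
    rw [hHt μ w t]
    rfl
  hBt := hBt
  hmixt := hmixt

/-- [folklore] projection (`rfl`). -/
@[simp] theorem tabsOf_V : (tabsOf N V H cM vh₂S mixFF hV hH hB hmix hVt hHt hBt hmixt).V = V := rfl

/-- [folklore] projection (`rfl`). -/
@[simp] theorem tabsOf_H : (tabsOf N V H cM vh₂S mixFF hV hH hB hmix hVt hHt hBt hmixt).H = H := rfl

/-- [folklore] projection (`rfl`): the multiplier tables. -/
theorem tabsOf_M_apply (j : ℕ) (μ : Fin (d + 1)) (w : Site (d + 1)) :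
    (tabsOf N V H cM vh₂S mixFF hV hH hB hmix hVt hHt hBt hmixt).M j μ w = cM j • H μ w := rfl

/-- [folklore] projection (`rfl`). -/
@[simp] theorem tabsOf_vh₂S : (tabsOf N V H cM vh₂S mixFF hV hH hB hmix hVt hHt hBt hmixt).vh₂S = vh₂S := rfl

/-- [folklore] projection (`rfl`). -/
@[simp] theorem tabsOf_mixFF : (tabsOf N V H cM vh₂S mixFF hV hH hB hmix hVt hHt hBt hmixt).mixFF = mixFF := rfl

/-- [folklore] With `cM j := cΛ·wM1 j` the multiplier tables ARE `M1Of d N H cΛ` (`rfl`). -/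
theorem tabsOf_M_eq_M1Of [NeZero N] (cΛ : ℝ) :
    (tabsOf N V H (fun j => cΛ * wM1 d N j) vh₂S mixFF hV hH hB hmix hVt hHt hBt hmixt).M = M1Of d N H cΛ := rfl

end Def

/-! ## §2 an1's records are instances (`rfl`) -/

section Instances

variable (d) (Lc : ℕ) [NeZero Lc] (cΛ : ℝ)
  (vh₂S mixFF : Fin (d + 1) → Site (d + 1) → Fin (d + 1) → Site (d + 1) → MKer (d + 1) (Fib d))
  (hB : ∃ C δ : ℝ, 0 < δ ∧ LocStencil₂ vh₂S C δ) (hmix : ∃ C δ : ℝ, 0 < δ ∧ LocStencilFM Lc mixFF C δ)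
  (hBt : ∀ (κ : Fin (d + 1)) (u : Site (d + 1)) (κ' : Fin (d + 1)) (u' t : Site (d + 1)),
    vh₂S κ (u + (Lc : ℤ) • t) κ' (u' + (Lc : ℤ) • t) = shiftK (-((Lc : ℤ) • t)) (vh₂S κ u κ' u'))
  (hmixt : ∀ (κ : Fin (d + 1)) (u : Site (d + 1)) (μ : Fin (d + 1)) (w t : Site (d + 1)),
    mixFF κ (u + (Lc : ℤ) • t) μ (w + t) = shiftK (-((Lc : ℤ) • t)) (mixFF κ u μ w))

/-- [folklore] **an1's (0.4) record with displayed second-order tables IS `tabsOf` at an1's first-order sym tables** (`rfl`: the data fields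
agree definitionally, the letter fields are propositions). -/
theorem symTablesAn1_eq_tabsOf :
    symTablesAn1 d Lc cΛ vh₂S mixFF hB hmix hBt hmixt
      = tabsOf Lc (symVhSAt (ctr (d + 1) Lc) d Lc) (symHessFFAt (ctr (d + 1) Lc) Lc) (fun j => cΛ * wM1 d Lc j) vh₂S mixFF
          (symVhSAt_hV_ctr (one_le_of_neZero Lc)) (symHessFFAt_hH_ctr (one_le_of_neZero Lc)) hB hmix
          (symVhSAt_hVt_ctr (one_le_of_neZero Lc)) (symHessFFAt_hHt_ctr Lc) hBt hmixt := rfl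

/-- [folklore] **an1's CLOSED (0.4) record `symTablesAn1S2` IS `tabsOf` at an1's five sym tables** (`rfl`). -/
theorem symTablesAn1S2_eq_tabsOf :
    symTablesAn1S2 d Lc cΛ
      = tabsOf Lc (symVhSAt (ctr (d + 1) Lc) d Lc) (symHessFFAt (ctr (d + 1) Lc) Lc) (fun j => cΛ * wM1 d Lc j) (symVh₂SAn1 d Lc)
          (symMixFFAt (ctr (d + 1) Lc) Lc) (symVhSAt_hV_ctr (one_le_of_neZero Lc)) (symHessFFAt_hH_ctr (one_le_of_neZero Lc))
          (locStencil₂_symVh₂SAn1 (one_le_of_neZero Lc)) (symMixFFAt_hmix_ctr (one_le_of_neZero Lc))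
          (symVhSAt_hVt_ctr (one_le_of_neZero Lc)) (symHessFFAt_hHt_ctr Lc) (symVh₂SAn1_hBt (one_le_of_neZero Lc))
          (symMixFFAt_hmixt (ctr (d + 1) Lc) Lc) := rfl

end Instances

end Summit.QuantumFields.BalabanUV.Beta.SymTablesOf

end
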